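import Literature.Analysis.Distribution.TranslationQuasiInvariantFunctional
import HarnessLib

/-!
# Translation-quasi-invariant finite-order functionals on a saturated open set

Topic `Analysis/Distribution`; namespace `Literature.Analysis.Distribution`. The relative version of
`TranslationQuasiInvariantFunctional` (Hörmander, *ALPDO I*, Thm. 3.1.4' is stated for distributions on
`Y × I`, an open subset): the functional `D` is only assumed additive, homogeneous, of finite order and
quasi-invariant on test functions supported in a set `W ⊆ X` which is **saturated** along `v`
(`x ∈ W ⟹ s v + (x - (φ x) v) ∈ W`, i.e. `W + ℝ v = W`), and the conclusion
`D f = D (P f)`, `P f = e_{-λ} · ρ(φ) · A (e_λ f)` (`lineProj`), holds for test functions supported in `W`.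
This is the form needed on the big Bruhat cell `N w⁰ A N ≅ 𝔫 × (K_∞ˣ)ⁿ × 𝔫` (saturated along the
`𝔫`-directions, not all of `𝔫 × K_∞ⁿ × 𝔫`). All constructions (`linePrimitive`, `fibreIntegral`,
`reinsert`, `twistFn`) are those of the absolute file; only the support bookkeeping is added:

* `IsSaturated v φ W`, `IsFiniteOrderOn W D`;
* supports: `tsupport (linePrimitive …) ⊆ W`, `tsupport (reinsert φ (fibreIntegral v φ k)) ⊆ W`, translates,
  for inputs supported in a saturated `W`;
* `hasDerivAt_apply_translate_on` (DIFF), `apply_vecDeriv_eq_on`, `apply_twist_vecDeriv_eq_zero_on`,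
  `apply_eq_apply_lineProj_on` (FACT), and the iteration over a list of directions
  `apply_eq_apply_lineProjList_on` (plain induction: `D f = D (P_{d_k} ⋯ P_{d_1} f)`).

Everything is proved; no named fact is introduced.

## References

* L. Hörmander, *The Analysis of Linear Partial Differential Operators I* (1983/2003), Def. 2.1.1,
  Thm. 3.1.4, Thm. 3.1.4', Cor. 3.1.5 [HormanderALPDO1].
-/

noncomputable section

open MeasureTheory Set Filter Topology Function
open scoped ContDiff ComplexConjugate

namespace Literature.Analysis.Distribution

variable {X : Type*} [NormedAddCommGroup X] [NormedSpace ℝ X]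

/-! ### 1. Saturated sets and finite order on a set -/

/-- **`W` is saturated along `v`** (with respect to the complement `ker φ`): with `x` it contains the whole
line `ℝ v + (x - (φ x) v)`. [folklore] -/
def IsSaturated (v : X) (φ : X →L[ℝ] ℝ) (W : Set X) : Prop :=
  ∀ x ∈ W, ∀ s : ℝ, s • v + (x - (φ x) • v) ∈ W

/-- A saturated set contains the translates `x + t v` of its points. [folklore] -/
theorem IsSaturated.add_smul_mem {v : X} {φ : X →L[ℝ] ℝ} {W : Set X} (hW : IsSaturated v φ W)
    {x : X} (hx : x ∈ W) (t : ℝ) : x + t • v ∈ W := by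
  have h := hW x hx (φ x + t)
  rwa [add_smul, show (φ x) • v + t • v + (x - (φ x) • v) = x + t • v by abel] at h

/-- A saturated set contains `x - u` for `u ∈ ℝ v`. [folklore] -/
theorem IsSaturated.sub_smul_mem {v : X} {φ : X →L[ℝ] ℝ} {W : Set X} (hW : IsSaturated v φ W)
    {x : X} (hx : x ∈ W) (t : ℝ) : x - t • v ∈ W := by
  have h := hW.add_smul_mem hx (-t)
  rwa [neg_smul, ← sub_eq_add_neg] at h

/-- **Finite order on `W`**: the continuity estimate of `IsFiniteOrder`, required only on compact subsets
of `W`. [cite: HormanderALPDO1, Def. 2.1.1] -/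
def IsFiniteOrderOn (W : Set X) (D : (X → ℂ) → ℂ) : Prop :=
  ∀ κ : Set X, IsCompact κ → κ ⊆ W → ∃ (C : ℝ) (𝒮 : Finset (List X)), 0 ≤ C ∧
    ∀ f : X → ℂ, IsTestFn f → tsupport f ⊆ κ →
      ∀ M : ℝ, (∀ w ∈ 𝒮, ∀ x, ‖vecWordDeriv w f x‖ ≤ M) → ‖D f‖ ≤ C * M

/-- Finite order everywhere is finite order on every `W`. [folklore] -/
theorem IsFiniteOrder.isFiniteOrderOn {D : (X → ℂ) → ℂ} (hD : IsFiniteOrder D) (W : Set X) : IsFiniteOrderOn W D :=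
  fun κ hκ _ => hD κ hκ

/-! ### 2. Supports of the constructions inside a saturated set -/

section Supports

variable {v : X} {φ : X →L[ℝ] ℝ} {W : Set X}

/-- Translates of functions supported in `W` by multiples of `v` are supported in `W`. [folklore] -/
theorem tsupport_translate_subset_of_saturated (hW : IsSaturated v φ W)
    {f : X → ℂ} (hf : tsupport f ⊆ W) (t : ℝ) : tsupport (translate (t • v) f) ⊆ W := by
  intro x hx
  obtain ⟨y, hy, rfl⟩ := tsupport_translate_subset (t • v) f hx
  exact hW.add_smul_mem (hf hy) t

/-- The saturation image `{s v + (z - (φ z) v)}` of a subset of `W` lies in `W`. [folklore] -/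
theorem image_line_subset_of_saturated (hW : IsSaturated v φ W) {S : Set ℝ} {K : Set X} (hK : K ⊆ W) :
    (fun p : ℝ × X => p.1 • v + (p.2 - (φ p.2) • v)) '' (S ×ˢ K) ⊆ W := by
  rintro _ ⟨⟨s, z⟩, ⟨_, hz⟩, rfl⟩
  exact hW z (hK hz) s

end Supports

section Supports2

variable (v : X) (φ : X →L[ℝ] ℝ) {W : Set X}

/-- **(PRIM) with support control**: a test function supported in a saturated `W` all of whose integrals
along the lines `y + ℝ v` vanish is `∂_v G` for a test function `G` supported in `W`.
[cite: HormanderALPDO1, Thm. 3.1.4, Thm. 3.1.4' (proofs)] -/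
theorem exists_vecDeriv_eq_of_integral_eq_zero_on [FiniteDimensional ℝ X] (hφ : φ v = 1) (hW : IsSaturated v φ W)
    {g : X → ℂ} (hg : IsTestFn g) (hgW : tsupport g ⊆ W) (h0 : ∀ y : X, ∫ s : ℝ, g (s • v + y) = 0) :
    ∃ G : X → ℂ, IsTestFn G ∧ tsupport G ⊆ W ∧ vecDeriv v G = g := by
  obtain ⟨R, hR⟩ := hg.hasCompactSupport.isCompact.exists_bound_of_continuousOn φ.continuous.continuousOn
  have ha : ∀ z ∈ tsupport g, -R - 1 < φ z := fun z hz => by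
    have h := (abs_le.1 ((Real.norm_eq_abs _).symm.le.trans (hR z hz))).1; linarith
  have hb : ∀ z ∈ tsupport g, φ z < R + 1 := fun z hz => by
    have h := (abs_le.1 ((Real.norm_eq_abs _).symm.le.trans (hR z hz))).2; linarith
  have hsub := tsupport_linePrimitive_subset v φ hφ hg ha hb h0
  have hSc : IsCompact ((fun p : ℝ × X => p.1 • v + (p.2 - (φ p.2) • v)) '' (Icc (-R - 1) (R + 1) ×ˢ tsupport g)) :=
    (isCompact_Icc.prod hg.hasCompactSupport.isCompact).image
      ((continuous_fst.smul continuous_const).add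
        (continuous_snd.sub ((φ.continuous.comp continuous_snd).smul continuous_const)))
  exact ⟨linePrimitive v φ (-R - 1) g,
    ⟨contDiff_linePrimitive v φ _ hg.contDiff, IsCompact.of_isClosed_subset hSc (isClosed_tsupport _) hsub⟩,
    hsub.trans (image_line_subset_of_saturated hW hgW), funext fun x => vecDeriv_linePrimitive v φ hφ _ hg.contDiff x⟩

/-- **Support of the reinserted fibre integral**: inside the saturation of `tsupport k`. [folklore] -/
theorem tsupport_reinsert_fibreIntegral_subset (hφ : φ v = 1) (k : X → ℂ) :
    tsupport (reinsert φ (fibreIntegral v φ k)) ⊆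
      closure ((fun p : ℝ × X => p.1 • v + (p.2 - (φ p.2) • v)) '' (tsupport stdBump ×ˢ tsupport k)) := by
  refine closure_mono fun x hx => ?_
  rw [mem_support] at hx
  unfold reinsert at hx
  have h1 : stdBump (φ x) ≠ 0 := fun h => hx (by rw [h]; simp)
  have h2 : fibreIntegral v φ k x ≠ 0 := fun h => hx (by rw [h]; simp)
  have hex : ∃ s : ℝ, k (s • v + (x - (φ x) • v)) ≠ 0 := by
    by_contra hall
    push Not at hall
    apply h2
    unfold fibreIntegral
    simp [hall]
  obtain ⟨s, hs⟩ := hex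
  refine ⟨(φ x, s • v + (x - (φ x) • v)), ⟨subset_tsupport _ h1, subset_tsupport _ hs⟩, ?_⟩
  simp only
  rw [apply_line v φ hφ x s]
  have : s • v + (x - (φ x) • v) - s • v = x - (φ x) • v := by abel
  rw [this, line_decomp]

/-- The reinserted fibre integral of a test function supported in a saturated `W` is supported in `W`.
[folklore] -/
theorem tsupport_reinsert_fibreIntegral_subset_of_saturated (hφ : φ v = 1) (hW : IsSaturated v φ W)
    {k : X → ℂ} (hk : IsTestFn k) (hkW : tsupport k ⊆ W) : tsupport (reinsert φ (fibreIntegral v φ k)) ⊆ W := by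
  have hSc : IsCompact ((fun p : ℝ × X => p.1 • v + (p.2 - (φ p.2) • v)) '' (tsupport stdBump ×ˢ tsupport k)) :=
    (hasCompactSupport_stdBump.isCompact.prod hk.hasCompactSupport.isCompact).image
      ((continuous_fst.smul continuous_const).add
        (continuous_snd.sub ((φ.continuous.comp continuous_snd).smul continuous_const)))
  refine (tsupport_reinsert_fibreIntegral_subset v φ hφ k).trans ?_
  rw [hSc.isClosed.closure_eq]
  exact image_line_subset_of_saturated hW hkW

end Supports2

/-! ### 3. (DIFF), the infinitesimal relation and (FACT) on a saturated set -/

section Main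

variable (v : X) (φ : X →L[ℝ] ℝ) {W : Set X} {D : (X → ℂ) → ℂ}

/-- **(DIFF) on `W`**: `t ↦ D (τ_{t v} f)` has derivative `-D (∂_v f)` at `0` for test `f` supported in the
saturated set `W`. [cite: HormanderALPDO1, Thm. 2.1.3] -/
theorem hasDerivAt_apply_translate_on (hW : IsSaturated v φ W)
    (hadd : ∀ f g : X → ℂ, IsTestFn f → IsTestFn g → tsupport f ⊆ W → tsupport g ⊆ W → D (f + g) = D f + D g)
    (hsmul : ∀ (c : ℂ) (f : X → ℂ), IsTestFn f → tsupport f ⊆ W → D (c • f) = c * D f)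
    (hD : IsFiniteOrderOn W D) {f : X → ℂ} (hf : IsTestFn f) (hfW : tsupport f ⊆ W) :
    HasDerivAt (fun t : ℝ => D (translate (t • v) f)) (-D (vecDeriv v f)) 0 := by
  -- a compact subset of `W` containing the supports of all `τ_{t v} f`, `|t| ≤ 1`, and of `∂_v f`
  set κ : Set X := (fun p : X × ℝ => p.1 + p.2 • v) '' (tsupport f ×ˢ Icc (-1 : ℝ) 1) with hκ
  have hκc : IsCompact κ :=
    (hf.hasCompactSupport.isCompact.prod isCompact_Icc).image (continuous_fst.add (continuous_snd.smul continuous_const))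
  have hκW : κ ⊆ W := by
    rintro _ ⟨⟨y, t⟩, ⟨hy, _⟩, rfl⟩
    exact hW.add_smul_mem (hfW hy) t
  have hsub_f : tsupport f ⊆ κ := fun x hx => ⟨(x, 0), ⟨hx, by norm_num, by norm_num⟩, by simp⟩
  have hsub_t : ∀ t : ℝ, |t| ≤ 1 → tsupport (translate (t • v) f) ⊆ κ := by
    intro t ht x hx
    obtain ⟨y, hy, rfl⟩ := tsupport_translate_subset (t • v) f hx
    exact ⟨(y, t), ⟨hy, abs_le.1 ht⟩, rfl⟩
  obtain ⟨C, 𝒮, hC, hbound⟩ := hD κ hκc hκW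
  rw [hasDerivAt_iff_tendsto_slope_zero]
  refine Metric.tendsto_nhdsWithin_nhds.2 fun ε hε => ?_
  have hδw : ∀ w ∈ 𝒮, ∃ δ > (0 : ℝ), ∀ t : ℝ, t ≠ 0 → |t| ≤ δ → ∀ x : X,
      ‖(vecWordDeriv w f (x - t • v) - vecWordDeriv w f x) / (t : ℂ) + vecDeriv v (vecWordDeriv w f) x‖ ≤
        ε / (2 * (C + 1)) := fun w _ =>
    exists_forall_norm_diffQuot_le (hf.vecWordDeriv w) v (div_pos hε (by positivity))
  classical
  choose! δ hδ0 hδ using hδw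
  set δ₀ : ℝ := (insert 1 (𝒮.image δ)).min' (Finset.insert_nonempty _ _) with hδ₀
  have hδ₀pos : 0 < δ₀ := by
    rw [hδ₀, Finset.lt_min'_iff]
    intro y hy
    rcases Finset.mem_insert.1 hy with rfl | hy
    · exact one_pos
    · obtain ⟨w, hw, rfl⟩ := Finset.mem_image.1 hy
      exact hδ0 w hw
  have hδ₀le1 : δ₀ ≤ 1 := Finset.min'_le _ _ (Finset.mem_insert_self _ _)
  have hδ₀le : ∀ w ∈ 𝒮, δ₀ ≤ δ w := fun w hw =>
    Finset.min'_le _ _ (Finset.mem_insert_of_mem (Finset.mem_image_of_mem δ hw))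
  refine ⟨δ₀, hδ₀pos, fun {t} ht hdist => ?_⟩
  have ht0 : t ≠ 0 := ht
  have htδ : |t| < δ₀ := by
    rwa [dist_zero_right, Real.norm_eq_abs] at hdist
  -- supports in `W`
  have hτ : IsTestFn (translate (t • v) f) := hf.translate _
  have hτW : tsupport (translate (t • v) f) ⊆ W := tsupport_translate_subset_of_saturated hW hfW t
  have hdW : tsupport (vecDeriv v f) ⊆ W := (tsupport_vecDeriv_subset v f).trans hfW
  have hdfW : tsupport (translate (t • v) f - f) ⊆ W :=
    (tsupport_sub _ _).trans (union_subset hτW hfW)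
  have hsmW : tsupport ((t : ℂ)⁻¹ • (translate (t • v) f - f)) ⊆ W :=
    (tsupport_smul_subset_right (fun _ : X => (t : ℂ)⁻¹) (translate (t • v) f - f)).trans hdfW
  -- linearity: the slope is `D (q_t)`
  have hsub : D (translate (t • v) f - f) = D (translate (t • v) f) - D f := by
    have h := hadd (translate (t • v) f - f) f (hτ.sub hf) hf hdfW hfW
    rw [sub_add_cancel] at h
    linear_combination -h
  set q : X → ℂ := (t : ℂ)⁻¹ • (translate (t • v) f - f) + vecDeriv v f with hq
  have hqt : IsTestFn q := ((hτ.sub hf).smul _).add (hf.vecDeriv v)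
  have hslope : (t⁻¹ : ℝ) • (D (translate (t • v) f) - D (translate ((0 : ℝ) • v) f)) - -D (vecDeriv v f) = D q := by
    have h0 : translate ((0 : ℝ) • v) f = f := by funext x; simp only [translate_apply, zero_smul, sub_zero]
    rw [h0, hq, hadd _ _ ((hτ.sub hf).smul _) (hf.vecDeriv v) hsmW hdW, hsmul _ _ (hτ.sub hf) hdfW, hsub,
      Complex.real_smul, Complex.ofReal_inv]
    ring
  rw [dist_eq_norm]
  simp only [zero_add]
  rw [hslope]
  have hqκ : tsupport q ⊆ κ := by
    refine (tsupport_add _ _).trans (union_subset ?_ ((tsupport_vecDeriv_subset v f).trans hsub_f))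
    have hsm : tsupport ((t : ℂ)⁻¹ • (translate (t • v) f - f)) ⊆ tsupport (translate (t • v) f - f) :=
      tsupport_smul_subset_right (fun _ : X => (t : ℂ)⁻¹) (translate (t • v) f - f)
    refine hsm.trans ?_
    exact (tsupport_sub _ _).trans (union_subset (hsub_t t (htδ.le.trans hδ₀le1)) hsub_f)
  have hwq : ∀ w ∈ 𝒮, ∀ x, ‖vecWordDeriv w q x‖ ≤ ε / (2 * (C + 1)) := by
    intro w hw x
    have hlin : vecWordDeriv w q = (t : ℂ)⁻¹ • (translate (t • v) (vecWordDeriv w f) - vecWordDeriv w f) +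
        vecDeriv v (vecWordDeriv w f) := by
      rw [hq, vecWordDeriv_add ((hτ.sub hf).smul _) (hf.vecDeriv v) w, vecWordDeriv_smul, sub_eq_add_neg,
        vecWordDeriv_add hτ hf.neg w, vecWordDeriv_translate, vecWordDeriv_vecDeriv hf v w]
      have hneg : vecWordDeriv w (-f) = -vecWordDeriv w f := by
        have h := vecWordDeriv_smul (-1 : ℂ) f w
        simpa using h
      rw [hneg, ← sub_eq_add_neg]
    rw [hlin]
    have h := hδ w hw t ht0 (htδ.le.trans (hδ₀le w hw)) x
    simpa only [Pi.add_apply, Pi.smul_apply, Pi.sub_apply, translate_apply, smul_eq_mul, div_eq_inv_mul] using h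
  calc ‖D q‖ ≤ C * (ε / (2 * (C + 1))) := hbound q hqt hqκ _ hwq
    _ < ε := by
        rw [mul_div_assoc']
        rw [div_lt_iff₀ (by positivity)]
        nlinarith

/-- **The infinitesimal relation on `W`**: `D (∂_v f) = -iλ D f`. [folklore] -/
theorem apply_vecDeriv_eq_on (hW : IsSaturated v φ W)
    (hadd : ∀ f g : X → ℂ, IsTestFn f → IsTestFn g → tsupport f ⊆ W → tsupport g ⊆ W → D (f + g) = D f + D g)
    (hsmul : ∀ (c : ℂ) (f : X → ℂ), IsTestFn f → tsupport f ⊆ W → D (c • f) = c * D f)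
    (hD : IsFiniteOrderOn W D) {lam : ℝ}
    (hq : ∀ f : X → ℂ, IsTestFn f → tsupport f ⊆ W → ∀ t : ℝ,
      D (translate (t • v) f) = Complex.exp (((lam * t : ℝ) : ℂ) * Complex.I) * D f)
    {f : X → ℂ} (hf : IsTestFn f) (hfW : tsupport f ⊆ W) :
    D (vecDeriv v f) = -((((lam : ℝ) : ℂ) * Complex.I) * D f) := by
  have h1 := hasDerivAt_apply_translate_on v φ hW hadd hsmul hD hf hfW
  have h2 : HasDerivAt (fun t : ℝ => Complex.exp (((lam * t : ℝ) : ℂ) * Complex.I) * D f)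
      ((((lam : ℝ) : ℂ) * Complex.I) * D f) 0 := by
    have ha : HasDerivAt (fun t : ℝ => ((lam * t : ℝ) : ℂ) * Complex.I) (((lam : ℝ) : ℂ) * Complex.I) 0 := by
      have h := ((Complex.ofRealCLM.hasDerivAt (x := (0 : ℝ))).const_mul ((lam : ℝ) : ℂ)).mul_const Complex.I
      have h' : HasDerivAt (fun t : ℝ => ((lam : ℝ) : ℂ) * (t : ℂ) * Complex.I) (((lam : ℝ) : ℂ) * Complex.I) 0 := by
        refine h.congr_deriv ?_
        simp
      refine h'.congr_of_eventuallyEq (Eventually.of_forall fun t => ?_)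
      simp only [Complex.ofReal_mul]
    have hb := ((Complex.hasDerivAt_exp _).comp (0 : ℝ) ha).mul_const (D f)
    simpa using hb
  have heq : (fun t : ℝ => D (translate (t • v) f)) = fun t : ℝ => Complex.exp (((lam * t : ℝ) : ℂ) * Complex.I) * D f :=
    funext fun t => hq f hf hfW t
  rw [heq] at h1
  have h := h1.unique h2
  linear_combination -h

/-- **The twisted functional kills `∂_v`-derivatives on `W`**: `D (e_{-λ} ∂_v G) = 0`. [folklore] -/
theorem apply_twist_vecDeriv_eq_zero_on (hφ : φ v = 1) (hW : IsSaturated v φ W)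
    (hadd : ∀ f g : X → ℂ, IsTestFn f → IsTestFn g → tsupport f ⊆ W → tsupport g ⊆ W → D (f + g) = D f + D g)
    (hsmul : ∀ (c : ℂ) (f : X → ℂ), IsTestFn f → tsupport f ⊆ W → D (c • f) = c * D f)
    (hD : IsFiniteOrderOn W D) {lam : ℝ}
    (hq : ∀ f : X → ℂ, IsTestFn f → tsupport f ⊆ W → ∀ t : ℝ,
      D (translate (t • v) f) = Complex.exp (((lam * t : ℝ) : ℂ) * Complex.I) * D f)
    {G : X → ℂ} (hG : IsTestFn G) (hGW : tsupport G ⊆ W) :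
    D (fun x => twistFn φ (-lam) x * vecDeriv v G x) = 0 := by
  have hGd : Differentiable ℝ G := hG.contDiff.differentiable (by simp)
  have heG : IsTestFn fun x => twistFn φ (-lam) x * G x := hG.mul_left (contDiff_twistFn φ _)
  have heGW : tsupport (fun x => twistFn φ (-lam) x * G x) ⊆ W :=
    (tsupport_mul_subset_right (f := twistFn φ (-lam)) (g := G)).trans hGW
  have h1 := apply_vecDeriv_eq_on v φ hW hadd hsmul hD hq heG heGW
  have hsplit : vecDeriv v (fun x => twistFn φ (-lam) x * G x) =
      (-(((lam : ℝ) : ℂ) * Complex.I)) • (fun x => twistFn φ (-lam) x * G x) +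
        fun x => twistFn φ (-lam) x * vecDeriv v G x := by
    funext x
    rw [vecDeriv_twistFn_mul v φ hφ (-lam) hGd x]
    simp only [Pi.add_apply, Pi.smul_apply, smul_eq_mul, Complex.ofReal_neg]
    ring
  have heG' : IsTestFn fun x => twistFn φ (-lam) x * vecDeriv v G x := (hG.vecDeriv v).mul_left (contDiff_twistFn φ _)
  have heG'W : tsupport (fun x => twistFn φ (-lam) x * vecDeriv v G x) ⊆ W :=
    (tsupport_mul_subset_right (f := twistFn φ (-lam)) (g := vecDeriv v G)).trans ((tsupport_vecDeriv_subset v G).trans hGW)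
  have hsmW : tsupport ((-(((lam : ℝ) : ℂ) * Complex.I)) • fun x => twistFn φ (-lam) x * G x) ⊆ W :=
    (tsupport_smul_subset_right (fun _ : X => -(((lam : ℝ) : ℂ) * Complex.I)) _).trans heGW
  rw [hsplit, hadd _ _ (heG.smul _) heG' hsmW heG'W, hsmul _ _ heG heGW] at h1
  linear_combination h1

/-- **The line projection** `P f = e_{-λ} · ρ(φ) · A (e_λ f)` along the direction `(v, φ, λ)`. [folklore] -/
def lineProj (lam : ℝ) (f : X → ℂ) (x : X) : ℂ :=
  twistFn φ (-lam) x * reinsert φ (fibreIntegral v φ (fun y => twistFn φ lam y * f y)) x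

/-- `P f` is a test function. [folklore] -/
theorem isTestFn_lineProj [FiniteDimensional ℝ X] (hφ : φ v = 1) (lam : ℝ) {f : X → ℂ} (hf : IsTestFn f) :
    IsTestFn (lineProj v φ lam f) :=
  (isTestFn_reinsert_fibreIntegral v φ hφ (hf.mul_left (contDiff_twistFn φ lam))).mul_left (contDiff_twistFn φ _)

/-- `P f` is supported in `W` when `f` is and `W` is saturated. [folklore] -/
theorem tsupport_lineProj_subset (hφ : φ v = 1) (hW : IsSaturated v φ W) (lam : ℝ) {f : X → ℂ} (hf : IsTestFn f)
    (hfW : tsupport f ⊆ W) : tsupport (lineProj v φ lam f) ⊆ W := by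
  unfold lineProj
  refine (tsupport_mul_subset_right (f := twistFn φ (-lam)) (g := reinsert φ (fibreIntegral v φ _))).trans ?_
  exact tsupport_reinsert_fibreIntegral_subset_of_saturated v φ hφ hW (hf.mul_left (contDiff_twistFn φ lam))
    ((tsupport_mul_subset_right (f := twistFn φ lam) (g := f)).trans hfW)

/-- **(FACT) on a saturated set**: `D f = D (P f)` for test functions supported in `W`.
[cite: HormanderALPDO1, Thm. 3.1.4', Cor. 3.1.5] -/
theorem apply_eq_apply_lineProj_on [FiniteDimensional ℝ X] (hφ : φ v = 1) (hW : IsSaturated v φ W)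
    (hadd : ∀ f g : X → ℂ, IsTestFn f → IsTestFn g → tsupport f ⊆ W → tsupport g ⊆ W → D (f + g) = D f + D g)
    (hsmul : ∀ (c : ℂ) (f : X → ℂ), IsTestFn f → tsupport f ⊆ W → D (c • f) = c * D f)
    (hD : IsFiniteOrderOn W D) {lam : ℝ}
    (hq : ∀ f : X → ℂ, IsTestFn f → tsupport f ⊆ W → ∀ t : ℝ,
      D (translate (t • v) f) = Complex.exp (((lam * t : ℝ) : ℂ) * Complex.I) * D f)
    {f : X → ℂ} (hf : IsTestFn f) (hfW : tsupport f ⊆ W) :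
    D f = D (lineProj v φ lam f) := by
  have hsub : ∀ f g : X → ℂ, IsTestFn f → IsTestFn g → tsupport f ⊆ W → tsupport g ⊆ W → D (f - g) = D f - D g := by
    intro f g hf hg hfW hgW
    have h := hadd (f - g) g (hf.sub hg) hg ((tsupport_sub _ _).trans (union_subset hfW hgW)) hgW
    rw [sub_add_cancel] at h
    linear_combination -h
  set k : X → ℂ := fun y => twistFn φ lam y * f y with hk
  have hkt : IsTestFn k := hf.mul_left (contDiff_twistFn φ lam)
  have hkW : tsupport k ⊆ W := (tsupport_mul_subset_right (f := twistFn φ lam) (g := f)).trans hfW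
  set r : X → ℂ := reinsert φ (fibreIntegral v φ k) with hr
  have hrt : IsTestFn r := isTestFn_reinsert_fibreIntegral v φ hφ hkt
  have hrW : tsupport r ⊆ W := tsupport_reinsert_fibreIntegral_subset_of_saturated v φ hφ hW hkt hkW
  obtain ⟨G, hG, hGW, hGg⟩ := exists_vecDeriv_eq_of_integral_eq_zero_on v φ hφ hW (hkt.sub hrt)
    ((tsupport_sub _ _).trans (union_subset hkW hrW)) (integral_line_sub_reinsert v φ hφ hkt)
  have hzero := apply_twist_vecDeriv_eq_zero_on v φ hφ hW hadd hsmul hD hq hG hGW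
  rw [hGg] at hzero
  have hpt : (fun x => twistFn φ (-lam) x * (k - r) x) = f - fun x => twistFn φ (-lam) x * r x := by
    funext x
    simp only [Pi.sub_apply, hk]
    have h1 : twistFn φ (-lam) x * twistFn φ lam x = 1 := by
      rw [mul_comm]; exact twistFn_mul_twistFn_neg φ lam x
    linear_combination (f x) * h1
  have herW : tsupport (fun x => twistFn φ (-lam) x * r x) ⊆ W :=
    (tsupport_mul_subset_right (f := twistFn φ (-lam)) (g := r)).trans hrW
  rw [hpt, hsub _ _ hf (hrt.mul_left (contDiff_twistFn φ _)) hfW herW] at hzero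
  have h : D f = D (fun x => twistFn φ (-lam) x * r x) := by linear_combination hzero
  exact h

/-! ### 4. Iteration over a list of directions -/

/-- **A direction datum**: vector, complementary functional and character exponent. [folklore] -/
structure Direction (X : Type*) [NormedAddCommGroup X] [NormedSpace ℝ X] where
  /-- the direction of translation -/
  v : X
  /-- a functional with `φ v = 1` -/
  φ : X →L[ℝ] ℝ
  /-- the exponent of the character `t ↦ e^{iλt}` -/
  lam : ℝ
  /-- normalisation -/
  hφv : φ v = 1

/-- **The iterated line projection** `P_L f = P_{d_k} (⋯ (P_{d_1} f))` for `L = [d_1, …, d_k]`. [folklore] -/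
def lineProjList : List (Direction X) → (X → ℂ) → (X → ℂ)
  | [], f => f
  | d :: L, f => lineProjList L (lineProj d.v d.φ d.lam f)

/-- `P_L f` is a test function supported in `W` when `f` is and `W` is saturated along every direction of
`L`. [folklore] -/
theorem isTestFn_lineProjList [FiniteDimensional ℝ X] :
    ∀ (L : List (Direction X)) (_hW : ∀ d ∈ L, IsSaturated d.v d.φ W) {f : X → ℂ},
      IsTestFn f → tsupport f ⊆ W → IsTestFn (lineProjList L f) ∧ tsupport (lineProjList L f) ⊆ W
  | [], _, _, hf, hfW => ⟨hf, hfW⟩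
  | d :: L, hW, _, hf, hfW =>
    isTestFn_lineProjList L (fun e he => hW e (List.mem_cons_of_mem _ he))
      (isTestFn_lineProj d.v d.φ d.hφv d.lam hf)
      (tsupport_lineProj_subset d.v d.φ d.hφv (hW d List.mem_cons_self) d.lam hf hfW)

/-- **(FACT) iterated**: if `D` is quasi-invariant along every direction of `L` (with the corresponding
characters) on test functions supported in `W`, saturated along all of them, then `D f = D (P_L f)`.
[cite: HormanderALPDO1, Thm. 3.1.4'] -/
theorem apply_eq_apply_lineProjList_on [FiniteDimensional ℝ X]
    (hadd : ∀ f g : X → ℂ, IsTestFn f → IsTestFn g → tsupport f ⊆ W → tsupport g ⊆ W → D (f + g) = D f + D g)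
    (hsmul : ∀ (c : ℂ) (f : X → ℂ), IsTestFn f → tsupport f ⊆ W → D (c • f) = c * D f)
    (hD : IsFiniteOrderOn W D) :
    ∀ (L : List (Direction X)) (_hW : ∀ d ∈ L, IsSaturated d.v d.φ W)
      (_hq : ∀ d ∈ L, ∀ f : X → ℂ, IsTestFn f → tsupport f ⊆ W → ∀ t : ℝ,
        D (translate (t • d.v) f) = Complex.exp (((d.lam * t : ℝ) : ℂ) * Complex.I) * D f)
      {f : X → ℂ}, IsTestFn f → tsupport f ⊆ W → D f = D (lineProjList L f)
  | [], _, _, _, _, _ => rfl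
  | d :: L, hW, hq, f, hf, hfW => by
    have h1 : D f = D (lineProj d.v d.φ d.lam f) :=
      apply_eq_apply_lineProj_on d.v d.φ d.hφv (hW d List.mem_cons_self) hadd hsmul hD
        (hq d List.mem_cons_self) hf hfW
    rw [h1]
    exact apply_eq_apply_lineProjList_on hadd hsmul hD L (fun e he => hW e (List.mem_cons_of_mem _ he))
      (fun e he => hq e (List.mem_cons_of_mem _ he)) (isTestFn_lineProj d.v d.φ d.hφv d.lam hf)
      (tsupport_lineProj_subset d.v d.φ d.hφv (hW d List.mem_cons_self) d.lam hf hfW)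

end Main

end Literature.Analysis.Distribution
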